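import Summits.CriticalPhenomena.SAWScalingLimit.Theses.SAWLoopFugacityFlow
import Summits.CriticalPhenomena.SAWScalingLimit.Theorems.SimpleSubseqLimits.Negative.SimpleSubseqLimitsCore
import Literature.Probability.RandomPlanarGeometry.SimpleCurves
import Literature.Probability.RandomPlanarGeometry.HullSubdomainPullback
import Literature.Probability.RandomPlanarGeometry.CaratheodoryHalfPlaneProofs
import Literature.Probability.RandomPlanarGeometry.RestrictionHullsProofs
import Literature.Probability.RandomPlanarGeometry.RestrictionHullsRiemannProofs
import Literature.Probability.RandomPlanarGeometry.SLEExistenceNeEightHolds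
import Literature.Probability.RandomPlanarGeometry.JordanDomainProofs
import HarnessLib

/-!
# Line `marked-point-revisit` — the kernel-checked GLUE of the crux `SAWLoopFugacityFlow.SimpleSubseqLimits`
(stmt-CriticalPhenomena-4982; lead prover; registered skeleton
`Summits/CriticalPhenomena/SAWScalingLimit/Cruxes/SimpleSubseqLimits/Lines/marked-point-revisit.lean`)

The crux (shared verbatim by SAWSteinDefect / SAWTensorRG / SAWFrontierHomotopy): every subsequential
weak limit `ν` of the critical `δℤ²` SAW laws of a Dobrushin domain `(D; a, b)` is carried by SIMPLE
chords `a → b` in `cl D` meeting `∂D` only at `a, b`.  This file banks the line's COMPOSITION as a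
theorem of the tree (`line_glue`): the crux follows from
* SHAPE (`stub_rangeIsArc`, open: two probability measures on curve classes — `ν` carried by classes
  from `a` to `b` in `cl D`, `μ` by simple chords meeting `∂D` only at `a, b` — agreeing on the
  avoidance events of all inline hull subdomains (`AvoidanceAgree`) have `ν`-a.e. arc range
  (`HasArcRange`)),
* the LIMIT PASSAGE (`stub_noMarkedRevisit`: `NoTouchAt` + weak convergence ⇒ `NoMarkedRevisitFor ν`),
* the LATTICE INPUT (`stub_onePointNoTouch`, open: `IsEndpointApprox D a b → NoTouchAt D a b`, the
  one-point no-touch bound for the critical SAW — implied by the summit conjecture, necessary given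
  tightness, see `Theorems/SimpleSubseqLimits/Negative/SimpleSubseqLimitsThickeningNecessity.lean`),
* and the route's A-side items `AvoidanceLimit` (stmt-10649, open rank-2 crux), `AvoidancePassage`
  (stmt-4984), `SLEAvoidanceValue` (stmt-10651), `SLECarrier` (stmt-4985) BY NAME,
taking as hypotheses ALSO the two deterministic lemmas (`stub_shadowing`, `stub_markedOfShadowing`
— both LANDED, `Shadowing.stub_shadowing` p83755 and `Marked.stub_markedOfShadowing` p85368, under
definitionally equal copies of the vocabulary) so that this file is pure glue, and using the landed
free clauses `Negative.ae_source_target_range_of_weakLimitAlong` (p74405).  Also proved here: the route items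
deliver the avoidance agreement with an SLE(8/3) law (`avoidanceAgree_of_routeItems`).

The vocabulary below (`ShadowConfig`, `MarkedConfig`, `NearRevisit`, `latticeCurve`, `IsSubseqLimit`,
`HasArcRange`, `AvoidanceAgree`, `NoMarkedRevisitFor`, `NoTouchAt`) is VERBATIM the registered
skeleton's (and the stub files', sub-namespaces `Shadowing` / `Marked` / `Passage` / `ArcRange`),
kept in the sub-namespace `…MarkedPointRevisit.Glue`; all copies agree definitionally, so the stubs,
landed under any of these namespaces, discharge the hypotheses of `line_glue` by `exact`.
-/

noncomputable section

open MeasureTheory Filter Topology Set Metric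
open Literature.Probability.RandomPlanarGeometry Literature.Probability.LatticeModels
open scoped ENNReal NNReal BoundedContinuousFunction unitInterval

namespace Summit.CriticalPhenomena.SAWScalingLimit.Theorems.SimpleSubseqLimits.MarkedPointRevisit.Glue

open Summit.CriticalPhenomena.SAWScalingLimit.Theses.SAWLoopFugacityFlow
  (SimpleSubseqLimits AvoidanceLimit AvoidancePassage SLEAvoidanceValue SLECarrier)

/-! ## Vocabulary (verbatim the registered skeleton) -/

/-- **Shadowing configuration** of a curve `γ` against an injective curve `η`: at time `s` the curve
`γ` sits at the arc point `η y₁` for the FIRST time; up to the later time `t` it never passes beyond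
level `y₁` of the arc; and every level `y ∈ [y₀, y₁)` (a non-degenerate sub-arc) is visited both
before `s` and again in `(s, t]` — the sub-arc `η [y₀, y₁)` is *shadowed* (idea card
`marked-point-revisit`, lemma `Shadowing`). [folklore] -/
def ShadowConfig (η γ : Curve ℂ) (s t y₀ y₁ : I) : Prop :=
  s < t ∧ y₀ < y₁ ∧ γ s = η y₁ ∧ (∀ r : I, r < s → γ r ≠ η y₁) ∧
    (∀ r : I, r ≤ t → ∃ y : I, y ≤ y₁ ∧ γ r = η y) ∧
    ∀ y : I, y₀ ≤ y → y < y₁ →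
      (∃ r : I, r < s ∧ γ r = η y) ∧ (∃ r' : I, s < r' ∧ r' ≤ t ∧ γ r' = η y)

/-- **Marked first-hit configuration** of a curve `γ` at centre `z` and radii `ρ < R`: `T` is the
FIRST hitting time of `closedBall z ρ`, and `lam < T` is an entrance time into `closedBall z R` after
which `γ` stays in that closed ball up to `T`. The MARKED POINT is `γ lam ∈ sphere z R`: a function
of the past `γ|[0,T]` only, at distance `≥ R - ρ` from the tip `γ T`. [folklore] -/
def MarkedConfig (γ : Curve ℂ) (z : ℂ) (ρ R : ℝ) (lam T : I) : Prop :=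
  lam < T ∧ γ lam ∈ sphere z R ∧ (∀ u : I, lam ≤ u → u ≤ T → γ u ∈ closedBall z R) ∧
    γ T ∈ closedBall z ρ ∧ ∀ u : I, u < T → γ u ∉ closedBall z ρ

/-- **Thickened (open) marked-revisit configuration**: times `lam < T < t'` such that at `lam` the
curve is `R₁`-far from `z`, during `[lam, T]` it stays `R₂`-close, at `T` it is `r`-close, before
`lam` it was never `r`-close (so `T` may be taken to be the first `r`-approach), and at `t'` it
returns `ε`-close to the marked point `γ lam`. All inequalities strict and the two universal clauses
range over compact parameter intervals, so the configuration is open for the sup distance and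
invariant under increasing reparametrisation. Every `MarkedConfig γ z ρ R lam T` with an exact
revisit `γ t' = γ lam`, `T < t'`, is a `NearRevisit γ z r R₁ R₂ ε` for all `R₁ < R < R₂`, `ε > 0`
and every `r ∈ (ρ, min_{u ≤ lam} dist (γ u) z)` (a nonempty interval contained in `(ρ, R]`).
[folklore] -/
def NearRevisit (γ : Curve ℂ) (z : ℂ) (r R₁ R₂ ε : ℝ) : Prop :=
  ∃ lam T t' : I, lam < T ∧ T < t' ∧ R₁ < dist (γ lam) z ∧
    (∀ u : I, lam ≤ u → u ≤ T → dist (γ u) z < R₂) ∧ dist (γ T) z < r ∧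
    (∀ u : I, u ≤ lam → r < dist (γ u) z) ∧ dist (γ t') (γ lam) < ε

/-- The polyline of a lattice SAW: the canonical parametrised representative of `γ.curve`
(`SimpleGraph.Walk.toCurve` through the mesh points). [folklore] -/
def latticeCurve {Ω : Set ℂ} {δ : ℝ} {u v : Site 2} (γ : SAW.DomainSAW Ω δ u v) : Curve ℂ :=
  ⟨γ.walk.toCurve (meshPoint δ)⟩

/-- The class of the lattice polyline is the SAW's curve class (definitional). [folklore] -/
@[simp] theorem mk_latticeCurve {Ω : Set ℂ} {δ : ℝ} {u v : Site 2} (γ : SAW.DomainSAW Ω δ u v) :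
    CurveClass.mk (latticeCurve γ) = γ.curve := rfl

/-- `ν` is a **subsequential weak limit** of the pushed-forward critical `δℤ²` SAW laws of
`(D; a_δ, b_δ)` along the meshes `s n → 0⁺` — the three antecedents of the crux, verbatim. [folklore] -/
def IsSubseqLimit (D : DobrushinDomain) (a b : ℝ → Site 2) (s : ℕ → ℝ)
    (ν : Measure (CurveClass ℂ)) : Prop :=
  Tendsto s atTop (𝓝[>] (0 : ℝ)) ∧ IsProbabilityMeasure ν ∧
    ∀ f : CurveClass ℂ →ᵇ ℝ,
      Tendsto (fun n => ∫ γ, f γ.curve ∂(SAW.law D.carrier (s n) (a (s n)) (b (s n)))) atTop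
        (𝓝 (∫ x, f x ∂ν))

/-- **Arc range**: the class `c` has the RANGE of a simple chord `c'` of `(D; a, b)` lying in
`cl D` and meeting `∂D` only at `a, b` (the SHAPE clause of the line, one class at a time). [folklore] -/
def HasArcRange (D : DobrushinDomain) (c : CurveClass ℂ) : Prop :=
  ∃ c' ∈ CurveClass.simple, c'.source = D.pt 0 ∧ c'.target = D.pt 1 ∧
    c'.range ⊆ closure D.carrier ∧ c'.range ∩ frontier D.carrier ⊆ {D.pt 0, D.pt 1} ∧
    c'.range = c.range

/-- **Hull-avoidance agreement** of two measures on curve classes: `ν` and `μ` give the same mass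
to `{range ⊆ closure D'}` for every Dobrushin subdomain `D' ⊆ D` with the same marked points that
agrees with `D` in balls around them (the inline hull-subdomain condition of the route items
`AvoidanceLimit` / `AvoidancePassage` / `SLEAvoidanceValue` / `AvoidanceDeterminesLaw`). [folklore] -/
def AvoidanceAgree (D : DobrushinDomain) (ν μ : Measure (CurveClass ℂ)) : Prop :=
  ∀ D' : DobrushinDomain, D'.carrier ⊆ D.carrier → D'.pt 0 = D.pt 0 → D'.pt 1 = D.pt 1 →
    (∃ ε : ℝ, 0 < ε ∧ D'.carrier ∩ ball (D.pt 0) ε = D.carrier ∩ ball (D.pt 0) ε ∧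
      D'.carrier ∩ ball (D.pt 1) ε = D.carrier ∩ ball (D.pt 1) ε) →
    ν (CurveClass.rangeSubset (closure D'.carrier)) =
      μ (CurveClass.rangeSubset (closure D'.carrier))

/-- **No marked revisit under `ν`**: there is a DENSE set `S` of parameters `(z, ρ, R)` such that
`ν`-a.e. class has a representative `γ` which, for every `(z, ρ, R) ∈ S` and every marked first-hit
configuration `(lam, T)`, never returns to the marked point `γ lam` after `T` (the ORDER clause of
the line at the limit level; for `ρ ≥ R` or `ρ < 0` the configuration is empty). [folklore] -/
def NoMarkedRevisitFor (ν : Measure (CurveClass ℂ)) : Prop :=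
  ∃ S : Set (ℂ × ℝ × ℝ), Dense S ∧
    ∀ᵐ c ∂ν, ∃ γ : Curve ℂ, CurveClass.mk γ = c ∧
      ∀ p ∈ S, ∀ lam T : I, MarkedConfig γ p.1 p.2.1 p.2.2 lam T →
        ∀ t' : I, T < t' → γ t' ≠ γ lam

/-- **One-point no-touch at `(D; a_δ, b_δ)`** (the line's ONE lattice input, thickened
first-approach form): for the critical SAW law `P_δ = SAW.law D δ (a δ) (b δ)`, every centre `z`,
radii `0 < r < R` and `θ > 0` there are a return radius `ε > 0` and an annulus `R₁ < R < R₂` beyond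
`r` with `limsup_{δ → 0⁺} P_δ[NearRevisit (polyline) z r R₁ R₂ ε] ≤ θ` — at its first `r`-approach
of `z` the walk later comes back `ε`-close to a point of its final approach lying in `A(z; R₁, R₂)`
only with small probability. An unconditional probability of an open polyline event; an
`x_c`-statement (false for `x > x_c`, space-filling limits); implied by the summit conjecture
(nested thickenings of a marked revisit of a weak limit shrink to a double point). [folklore] -/
def NoTouchAt (D : DobrushinDomain) (a b : ℝ → Site 2) : Prop :=
  ∀ (z : ℂ) (r R : ℝ), 0 < r → r < R → ∀ θ : ℝ≥0∞, 0 < θ →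
    ∃ ε R₁ R₂ : ℝ, 0 < ε ∧ r < R₁ ∧ R₁ < R ∧ R < R₂ ∧
      limsup (fun δ : ℝ => SAW.law D.carrier δ (a δ) (b δ)
          {γ | NearRevisit (latticeCurve γ) z r R₁ R₂ ε}) (𝓝[>] (0 : ℝ)) ≤ θ

/-! ## The route items deliver the avoidance agreement -/

/-- `ε`-ball agreement of `D'` with `D` at `p` keeps `p` off `closure (D ∖ D')` (the inline hull
condition of the route items implies `MarkedDomain.IsHullSubdomain`). [folklore] -/
theorem notMem_closure_diff_of_ball_eq {D D' : DobrushinDomain} {p : ℂ} {ε : ℝ} (hε : 0 < ε)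
    (h : D'.carrier ∩ ball p ε = D.carrier ∩ ball p ε) :
    p ∉ closure (D.carrier \ D'.carrier) := by
  rw [Metric.mem_closure_iff]
  push Not
  refine ⟨ε, hε, fun x hx => ?_⟩
  by_contra hlt
  push Not at hlt
  have hxball : x ∈ D.carrier ∩ ball p ε := ⟨hx.1, by rw [mem_ball, dist_comm]; exact hlt⟩
  rw [← h] at hxball
  exact hx.2 hxball.1

/-- **The route delivers `AvoidanceAgree`**: for every subsequential weak limit `ν` there is a chordal
SLE(8/3) law `μ` of `(D; a, b)` with `AvoidanceAgree D ν μ` — `AvoidanceLimit` (stmt-10649) gives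
the lattice hull-avoidance limits `Φ'_A(0)^{5/8}` for the pulled-back `*`-hulls (chordal uniformizer
`MarkedDomain.exists_isChordalUniformizing_holds`, `IsStarHull.pullbackHull`, restriction data
`IsStarHull.existsUnique_isRestrictionMap_holds` / `exists_hasRestrictionDeriv_holds` — theorems),
`SLEAvoidanceValue` (stmt-10651) identifies the value as the SLE(8/3) avoidance probability (SLE law
`exists_isSLECurve_eightThirds`), and `AvoidancePassage` (stmt-4984) sandwiches the limit.
[folklore] -/
theorem avoidanceAgree_of_routeItems (hA : AvoidanceLimit) (hP : AvoidancePassage)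
    (hV : SLEAvoidanceValue) {D : DobrushinDomain} {a b : ℝ → Site 2}
    (hab : SAW.IsEndpointApprox D a b) {s : ℕ → ℝ} {ν : Measure (CurveClass ℂ)}
    (hlim : IsSubseqLimit D a b s ν) :
    ∃ μ : Measure (CurveClass ℂ), IsSLELaw ((8 : ℝ≥0) / 3) D μ ∧ AvoidanceAgree D ν μ := by
  obtain ⟨hs, hν, hw⟩ := hlim
  obtain ⟨Γ, hΓ⟩ := exists_isSLECurve_eightThirds D
  refine ⟨_, hΓ.isSLELaw_map, fun D' hsub h0 h1 hε => ?_⟩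
  refine hP D a b hab s ν _ hs hν hw hΓ.isSLELaw_map ?_ D' hsub h0 h1 hε
  intro D'' hsub'' h0'' h1'' hε''
  obtain ⟨ε, hεpos, hb0, hb1⟩ := hε''
  obtain ⟨φ, hφ⟩ := MarkedDomain.exists_isChordalUniformizing_holds D
  have hHS : D.IsHullSubdomain D'' :=
    ⟨hsub'', h0'', h1'', notMem_closure_diff_of_ball_eq hεpos hb0,
      notMem_closure_diff_of_ball_eq hεpos hb1⟩
  have hstar : IsStarHull (φ.pullbackHull D'') :=
    IsStarHull.pullbackHull JordanDomain.isSimplyConnected_holds hφ hHS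
  obtain ⟨Φ, hΦ, -⟩ := IsStarHull.existsUnique_isRestrictionMap_holds hstar
  obtain ⟨d, -, -, hd⟩ := IsStarHull.exists_hasRestrictionDeriv_holds hstar hΦ
  have hl := hA D D'' a b hab hsub'' h0'' h1'' ⟨ε, hεpos, hb0, hb1⟩ φ hφ (φ.pullbackHull D'')
    rfl Φ d hΦ hd
  have hval := hV D D'' _ hΓ.isSLELaw_map hsub'' h0'' h1'' ⟨ε, hεpos, hb0, hb1⟩ φ hφ
    (φ.pullbackHull D'') rfl Φ d hΦ hd
  rw [hval]
  exact hl.comp hs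

/-! ## The glue -/

/-- **LINE GLUE (registered obligation `line_glue` of crux stmt-CriticalPhenomena-4982).** The two
deterministic lemmas (`stub_shadowing`, `stub_markedOfShadowing`, landed) + SHAPE (`stub_rangeIsArc`)
+ LIMIT PASSAGE (`stub_noMarkedRevisit`) + LATTICE INPUT (`stub_onePointNoTouch`) + the A-side route
items imply the crux.  For `ν`-a.e. class `c`: the free
clauses give `c.source = a`, `c.target = b`, `c.range ⊆ cl D`; SHAPE (fed by `SLECarrier` and
`avoidanceAgree_of_routeItems`) gives an injective `η` with `range η = range c` from `a` to `b`
meeting `∂D` only at `a, b`; ORDER gives a representative `γ` of `c` with no marked revisit on a dense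
parameter set `S`.  If `c` were not simple, `γ` (with `γ 0 = a ≠ b = γ 1`) would not be flat
(`Curve.exists_isSimple_of_isFlat`), so `stub_shadowing` yields a shadowing configuration and
`stub_markedOfShadowing` an open set `U` of parameters with an exact marked revisit; `U`
meets `S` — contradiction.  The boundary clause is transported along `range c = range η`.
[folklore] -/
theorem line_glue :
    (∀ (η γ : Curve ℂ), η.IsSimple → Set.range γ = Set.range η → γ 0 = η 0 → ¬ γ.IsFlat →
      ∃ s t y₀ y₁ : I, ShadowConfig η γ s t y₀ y₁) →
    (∀ (η γ : Curve ℂ), η.IsSimple → Set.range γ = Set.range η → γ 0 = η 0 →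
      ∀ s t y₀ y₁ : I, ShadowConfig η γ s t y₀ y₁ →
        ∃ U : Set (ℂ × ℝ × ℝ), IsOpen U ∧ U.Nonempty ∧
          ∀ p ∈ U, ∃ lam T t' : I,
            MarkedConfig γ p.1 p.2.1 p.2.2 lam T ∧ T < t' ∧ γ t' = γ lam) →
    (∀ (D : DobrushinDomain) (ν μ : Measure (CurveClass ℂ)), IsProbabilityMeasure ν →
      IsProbabilityMeasure μ →
      (∀ᵐ c ∂ν, c.source = D.pt 0 ∧ c.target = D.pt 1 ∧ c.range ⊆ closure D.carrier) →
      (∀ᵐ γ ∂μ, γ ∈ CurveClass.simple ∧ γ.source = D.pt 0 ∧ γ.target = D.pt 1 ∧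
        γ.range ⊆ closure D.carrier ∧ γ.range ∩ frontier D.carrier ⊆ {D.pt 0, D.pt 1}) →
      AvoidanceAgree D ν μ → ∀ᵐ c ∂ν, HasArcRange D c) →
    (∀ (D : DobrushinDomain) (a b : ℝ → Site 2) (s : ℕ → ℝ) (ν : Measure (CurveClass ℂ)),
      NoTouchAt D a b → IsSubseqLimit D a b s ν → NoMarkedRevisitFor ν) →
    (∀ (D : DobrushinDomain) (a b : ℝ → Site 2), SAW.IsEndpointApprox D a b → NoTouchAt D a b) →
    AvoidanceLimit → AvoidancePassage → SLEAvoidanceValue → SLECarrier → SimpleSubseqLimits := by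
  intro hSh hMk hShape hPass hOP hA hP hV hC D a b hab s ν hs hν hlim
  haveI := hν
  have hsub : IsSubseqLimit D a b s ν := ⟨hs, hν, hlim⟩
  have hfree :=
    Summit.CriticalPhenomena.SAWScalingLimit.Theorems.SimpleSubseqLimits.Negative.ae_source_target_range_of_weakLimitAlong
      (ν := ν) hab hs hlim
  obtain ⟨μ, hμ, hagree⟩ := avoidanceAgree_of_routeItems hA hP hV hab hsub
  obtain ⟨hμP, hμcar⟩ := hC D μ hμ
  have hR := hShape D ν μ hν hμP hfree hμcar hagree
  obtain ⟨S, hSd, hN⟩ := hPass D a b s ν (hOP D a b hab) hsub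
  filter_upwards [hR, hN, hfree] with c hc hn hf
  obtain ⟨c', hc's, h0', h1', hcl, hfr, hrange⟩ := hc
  obtain ⟨γ, hγc, hγ⟩ := hn
  obtain ⟨hsrc, htgt, -⟩ := hf
  have hsimple : c ∈ CurveClass.simple := by
    by_contra hns
    obtain ⟨η, hη, hηc'⟩ := hc's
    have e1 : γ.source = D.pt 0 := by rw [← CurveClass.source_mk, hγc]; exact hsrc
    have e2 : η.source = D.pt 0 := by rw [← CurveClass.source_mk, hηc']; exact h0'
    have e3 : γ.target = D.pt 1 := by rw [← CurveClass.target_mk, hγc]; exact htgt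
    have e4 : η.target = D.pt 1 := by rw [← CurveClass.target_mk, hηc']; exact h1'
    have hγ0 : γ 0 = η 0 := e1.trans e2.symm
    have hγ1 : γ 1 = η 1 := e3.trans e4.symm
    have hrg : Set.range γ = Set.range η := by
      have h : (CurveClass.mk γ).range = (CurveClass.mk η).range := by rw [hγc, hηc', hrange]
      exact h
    have h01 : γ 0 ≠ γ 1 := by
      rw [hγ0, hγ1]
      exact fun h => zero_ne_one (hη h)
    have hflat : ¬ γ.IsFlat := by
      intro hfl
      obtain ⟨γ₀, hγ₀, -, hd⟩ := Curve.exists_isSimple_of_isFlat hfl h01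
      apply hns
      rw [← hγc, CurveClass.mk_eq_mk_iff_dist_eq_zero.2 hd]
      exact CurveClass.mk_mem_simple hγ₀
    obtain ⟨s₀, t₀, y₀, y₁, hcfg⟩ := hSh η γ hη hrg hγ0 hflat
    obtain ⟨U, hUo, hUne, hU⟩ := hMk η γ hη hrg hγ0 s₀ t₀ y₀ y₁ hcfg
    obtain ⟨p, hpS, hpU⟩ := hSd.exists_mem_open hUo hUne
    obtain ⟨lam, T, t', hmk, hTt, heq⟩ := hU p hpU
    exact hγ p hpS lam T hmk t' hTt heq
  exact ⟨hsimple, hsrc, htgt, hrange ▸ hcl, hrange ▸ hfr⟩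

end Summit.CriticalPhenomena.SAWScalingLimit.Theorems.SimpleSubseqLimits.MarkedPointRevisit.Glue

end
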